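import Literature.NumberTheory.Rogawski1990.ArchTransfFamilyJumpLocal       -- PART 3d (LH7-p02 (g2)): parity killer, local form + Leibniz expansion; brings PART 3a–3c, PART 2 (ED. 1), ★ Resolved
import Literature.NumberTheory.Rogawski1990.ArchTransfFamilyJumpJetsSum     -- PART 3b: `hasOneSidedJump_resolvedSum_jet`
import Literature.NumberTheory.Rogawski1990.ArchBouazizJumpPropagation      -- ★ p850369 (F0P3a-p02 (g19)) (π): `archBzJump_of_forall_gSemireg`
import Literature.NumberTheory.Rogawski1990.ArchTransfFamilySmoothBounded   -- ★ p850305 (LH3-p04 (g3)) (SB-TRANSF): `archBzSmoothBounded_transfFam_of_hc`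
import HarnessLib

/-!
# (I₃) for the candidate transfer family — PART 3e (ALL ORDERS): the pointwise identity `(P_n)` at the `G`-semiregular covered wall points and the organ head
# `archBzJump_transfFam_of_hc : ArchHCSpaceG … F → AgreesOnAdmissibleCoveredSlots … → ArchBzJump jcH (transfFam L α μ F)` (Shelstad 1979 Thm. 4.7 (IIIb); Bouaziz 1994 (I₃), Rem. 2)

Topic `NumberTheory/Rogawski1990`; namespace `Literature.NumberTheory.Rogawski1990`.  THEOREMS ONLY (no `def`, no instance, no notation, no axiom, no named fact, no `sorry`).
Cell `pub/hodgecm-mathlib`, line LH3 (closer stub `stub_N9`, crux H413 = `stmt-HodgeConjecture-24833`), organ **O-L2 (I₃-TRANSF)** — THE HEAD (LH3-plan (g3) DEALER BOARD g3 #1 (iv),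
RULING #2, 2026-09-02T07:53Z «= SPLIT»; author LH7-p02 (g2); the propagation half (π) is ★ F0P3a-p02 (g19), the generic calculus ★ F0P3a-p09 (g5)).  HONEST LABEL: HC_CM is proved
only modulo the 7 printed citations (2 remaining: hLiu418 = `stmt-HodgeConjecture-24832`, h413 = `stmt-HodgeConjecture-24833`) until rung 0 closes; count-neutral.

THE MATHEMATICS.  §1 `(P_n)`: at a `G`-semiregular point `p` of a covered wall `w₀ ∉ S` (`S` admissible), for every word `m`,
`ν ↦ bzTwistedDeriv S n (bzAdaptedVec w₀ ∘ m) (transfFam S) (p + ν•nrm w₀)` jumps by `2·jc′ S w₀ 0 2 · I^{a(m)} · bzTwistedDeriv S″ n (bzCayVec ∘ m) (transfFam S″) (cayPt w₀ p)`.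
Proof: near the curve `archERho_S·transfFam S = Σ_ρ κ_ρ·W_S·('F_S∘ρ)` (PART 3d), Leibniz over `s ⊆ Fin n` (★ LEIBNIZ-JET): the `W_S`-jets are continuous through the wall, the
partner-sum jets on the complementary sub-word jump by `(2+2(−1)^{a_s})·jc′₀₂·Σ_{ρ′} κ_{ρ′}·I^{a_s}·Y_{ρ′,s}` (PART 3b); on the Cayley side the same expansion at the TAME point
`cayPt w₀ p` with `W_{S″} = 2·(w_S·archERho_{S″}·Ũ)` (`w_S = w_{S″}∕2`) and `DW_S(p)(adapted) = D(w_S·archERho_{S″}·Ũ)(q)(Cayley)` (PART 3c), `archERho_S(p) = archERho_{S″}(q)`;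
term by term in `s`: a normal letter inside `s` kills both prefactor jets, otherwise `a_s = a(m)` and either `a(m)` is even (`2+2 = 4 = 2·2`) or odd (the factor `2−2 = 0` on the
left, the parity killer `Y_{ρ′,s} = 0` on the right).  §2 THE HEAD: ★ (SB-TRANSF) + ★ (π) `archBzJump_of_forall_gSemireg` reduce `ArchBzJump jcH (transfFam L α μ F)` to the
pointwise identities at the `G`-semiregular wall points; there `jcH S w₀ = 2·jc′ S w₀ 0 2` at the admissible covered walls (★ `AgreesOnAdmissibleCoveredSlots`), and at the other
walls both sides vanish at every order (inadmissible `S`: `transfFam S = 0`; uncovered `w₀`: every partner point is tame, the jets are continuous, and `insert w₀ S` is inadmissible).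

## References
* [Shelstad1979] D. Shelstad, *Characters and inner forms of a quasi-split group over ℝ*, Compositio Math. 39 (1979), §4: Lemma 4.3 p. 25, Prop. 4.5 p. 26, Thm. 4.7 (IIIb) p. 31.
* [Bouaziz1994IntegralesOrbitales] A. Bouaziz, *Intégrales orbitales sur les groupes de Lie réductifs*, Ann. Sci. ÉNS 27 (1994), §3.2 (I₃) p. 580, §6.2 p. 591, Rem. 2 p. 594.
* [Rogawski1990] J. D. Rogawski, *Automorphic Representations of Unitary Groups in Three Variables* (1990), §4.3 (4.3.1) p. 43, §4.9 p. 55, §8.2 pp. 119–123, §14.2 p. 232.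
-/

set_option autoImplicit false

noncomputable section

open NumberField NumberField.InfinitePlace Complex Set Filter Topology Equiv Finset
open scoped Classical Real ContDiff
open Literature.NumberTheory.Automorphic Literature.NumberTheory.Automorphic.UnitaryGroup Literature.NumberTheory.Automorphic.ArchCartan
open Literature.NumberTheory.Automorphic.Shelstad1979.StableOrbitalIntegrals
open Literature.NumberTheory.GaloisRepresentations
open Literature.Analysis.Calculus

namespace Literature.NumberTheory.Rogawski1990

/-! ## §0 Abstract bookkeeping of the double sums (kept abstract: the concrete terms are matched by unification only) -/

section Algebra

/-- The outer re-assembly: if every `s`-term of the left sum is `c · Σ_i κ_i · g s i`, then `E · Σ_s f s = c · (E · Σ_i κ_i · Σ_s g s i)`. [cite: Shelstad1979, Thm. 4.7 proof p. 31] -/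
theorem sum_assembly {σ ι : Type*} [Fintype σ] (T : Finset ι) (E c : ℂ) (f : σ → ℂ) (κ : ι → ℂ) (g : σ → ι → ℂ)
    (h : ∀ s, f s = c * ∑ i ∈ T, κ i * g s i) : E * ∑ s, f s = c * (E * ∑ i ∈ T, κ i * ∑ s, g s i) := by
  simp only [h, Finset.mul_sum]
  rw [Finset.sum_comm]
  refine Finset.sum_congr rfl fun i _ => Finset.sum_congr rfl fun s _ => ?_
  ring

/-- The per-`s` matching: with `A₂ = 2A` and one of (i) `A = 0` (a normal letter inside `s`), (ii) `x = 1 ∧ sc = sc′` (even count), (iii) `x = −1` and all `Y_i = 0` (odd count,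
parity killer), `A · ((2 + 2x) · Σ_i jc·κ_i·sc·Y_i) = 2·jc·sc′ · Σ_i κ_i·A₂·Y_i`. [cite: Shelstad1979, Thm. 4.7 proof p. 31] -/
theorem persum_identity {ι : Type*} (T : Finset ι) (κ Y : ι → ℂ) (A A₂ x jc sc sc' : ℂ) (hA₂ : A₂ = 2 * A)
    (h : A = 0 ∨ (x = 1 ∧ sc = sc') ∨ (x = -1 ∧ ∀ i ∈ T, Y i = 0)) :
    A * ((2 + 2 * x) * ∑ i ∈ T, jc * (κ i * (sc * Y i))) = 2 * jc * sc' * ∑ i ∈ T, κ i * (A₂ * Y i) := by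
  rcases h with hA | ⟨hx, hsc⟩ | ⟨hx, hY⟩
  · rw [hA₂, hA]
    simp only [mul_zero, zero_mul, Finset.sum_const_zero]
  · rw [hA₂, hx, hsc, Finset.mul_sum, Finset.mul_sum, Finset.mul_sum]
    refine Finset.sum_congr rfl fun i _ => ?_
    ring
  · have h1 : ∑ i ∈ T, jc * (κ i * (sc * Y i)) = 0 := Finset.sum_eq_zero fun i hi => by rw [hY i hi]; ring
    have h2 : ∑ i ∈ T, κ i * (A₂ * Y i) = 0 := Finset.sum_eq_zero fun i hi => by rw [hY i hi]; ring
    rw [h1, h2, hx]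
    ring

end Algebra

/-! ## §1 The pointwise all-orders identity at a `G`-semiregular covered wall point -/

section Pointwise

variable (L : Type) [Field L] [NumberField L] [IsCMField L] (α : Fin 3 → L) (μ : HeckeCharacter L)

set_option maxHeartbeats 800000 in
/-- **`(P_n)` — (I₃) AT ALL ORDERS FOR THE CANDIDATE TRANSFER FAMILY AT A `G`-SEMIREGULAR COVERED WALL POINT.**  House frame `α_i ≠ 0`, `μ`-guard `hμω`; `S` admissible, `w₀ ∉ S`
covered, `p` a `G`-semiregular point of the `H`-wall at `w₀`, `F ∈ ArchHCSpaceG (slotSign L α) jc′`; for every word `m` of adapted letters the twisted iterated derivative of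
`transfFam S` along the normal jumps by `2 · jc′ S w₀ 0 2 · bzCayScalar w₀ m · bzTwistedDeriv (insert w₀ S) n (Cayley m) (transfFam (insert w₀ S)) (cayPt w₀ p)`.
[cite: Shelstad1979, Thm. 4.7 (IIIb) p. 31; Lemma 4.3 p. 25] [cite: Bouaziz1994IntegralesOrbitales, §3.2 (I₃) p. 580; Rem. 2 p. 594] [cite: Rogawski1990, §4.3 (4.3.1) p. 43] -/
theorem transfFam_hasOneSidedJump_allOrders (hα : ∀ i, α i ≠ 0)
    (hμω : ∀ x : ideleGroup ↥(maximalRealSubfield L), μ (AdeleRing.ideleBaseChange (↥(maximalRealSubfield L)) L x) = quadraticHeckeCharCM L x)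
    {S : Finset {w : InfinitePlace L // IsComplex w}} (hS : ∀ w ∈ S, w ∈ splitChartPlaces L α)
    {w₀ : {w : InfinitePlace L // IsComplex w}} (hw₀ : w₀ ∉ S) (hcov : w₀ ∈ splitChartPlaces L α)
    {jc' : Finset {w : InfinitePlace L // IsComplex w} → {w : InfinitePlace L // IsComplex w} → Fin 3 → Fin 3 → ℂ}
    {F : Finset {w : InfinitePlace L // IsComplex w} → ({w : InfinitePlace L // IsComplex w} → Fin 3 → ℝ) → ℂ} (hF : ArchHCSpaceG (slotSign L α) jc' F)
    {p : {w : InfinitePlace L // IsComplex w} → Fin 3 → ℝ} (hs02 : p w₀ 0 = p w₀ 2) (hs1 : Circle.exp (p w₀ 1) ≠ Circle.exp (p w₀ 0))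
    (hreg : ∀ v, v ∉ S → v ≠ w₀ → Function.Injective fun i : Fin 3 => Circle.exp (p v i)) (hx : ∀ v ∈ S, p v 0 ≠ 0)
    (n : ℕ) (m : Fin n → {w : InfinitePlace L // IsComplex w} × Fin 3) :
    HasOneSidedJump (fun t : ℝ => bzTwistedDeriv S n (fun j => bzAdaptedVec w₀ (m j)) (transfFam L α μ F S) (p + t • nrm w₀))
      (2 * jc' S w₀ 0 2 * bzCayScalar w₀ m * bzTwistedDeriv (insert w₀ S) n (fun j => (bzCayVec (m j) : {w : InfinitePlace L // IsComplex w} → Fin 3 → ℝ)) (transfFam L α μ F (insert w₀ S)) (cayPt w₀ p)) := by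
  obtain ⟨k, hk⟩ := exists_archTau_mul_archWeylRatio_endoTorus_eq L μ hμω
  obtain ⟨-, hind⟩ := slotSign_zero_ne_two_of_mem_splitChartPlaces L α hα hcov
  have hS'' : ∀ w ∈ insert w₀ S, w ∈ splitChartPlaces L α := by
    intro w hw
    rcases Finset.mem_insert.1 hw with rfl | hw
    · exact hcov
    · exact hS w hw
  have hI1 : ContDiffOn ℝ ∞ (F S) (InRegG (slotSign L α) S) := (hF.2.2.1 S).1
  have hI1'' : ContDiffOn ℝ ∞ (F (insert w₀ S)) (InRegG (slotSign L α) (insert w₀ S)) := (hF.2.2.1 _).1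
  obtain ⟨hev, -⟩ := eventually_nhdsNE_mem_regG_add_smul_nrm hw₀ hs02 hs1 hreg hx
  have hpw : partnerWeight L α (insert w₀ S) = 2 * partnerWeight L α S := by
    rw [partnerWeight_eq_inv_two_mul_insert L α hw₀ hind]; ring
  -- the Cayley point is tame for `insert w₀ S`
  have hq : cayPt w₀ p ∈ InRegS (insert w₀ S) := by
    refine (cayPt_mem_inRegS_insert_iff S w₀ p).2 fun w hw => ?_
    have hw' : w ≠ w₀ ∧ w ∉ S := by simpa [Finset.mem_insert, not_or] using hw
    exact fun h => (show (0 : Fin 3) ≠ 2 by decide) (hreg w hw'.2 hw'.1 h)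
  have htame'' : ∀ ρ ∈ partnerPerms (insert w₀ S), slotPerm ρ (cayPt w₀ p) ∈ InRegG (slotSign L α) (insert w₀ S) := by
    refine forall_slotPerm_mem_inRegG_of_injective (slotSign L α) (insert w₀ S) fun w hw _ => ?_
    have hw' : w ≠ w₀ ∧ w ∉ S := by simpa [Finset.mem_insert, not_or] using hw
    simp only [cayPt_apply_of_ne hw'.1]
    exact hreg w hw'.2 hw'.1
  ---------------------------------------------------------------- Step A: the LHS off `t = 0`
  have hA : ∀ᶠ t in 𝓝[≠] (0 : ℝ), bzTwistedDeriv S n (fun j => bzAdaptedVec w₀ (m j)) (transfFam L α μ F S) (p + t • nrm w₀) =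
      (archERho S (p + t • nrm w₀))⁻¹ * ∑ s : Finset (Fin n),
        iteratedFDeriv ℝ s.card (fun c : {w : InfinitePlace L // IsComplex w} → Fin 3 → ℝ => partnerWeight L α S * (archERho S c * (∏ w : {w : InfinitePlace L // IsComplex w}, (if w ∈ S then Complex.exp (((2 * k w + 1 : ℤ) : ℂ) * ((c w 2 : ℂ) * I))
            else (((Circle.exp (c w 0) : ℂ) * Circle.exp (c w 2)) ^ (k w)) * (Circle.exp (c w 2) : ℂ))))) (p + t • nrm w₀) (fun i => bzAdaptedVec w₀ (m (s.orderEmbOfFin rfl i))) *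
        ∑ ρ ∈ partnerPerms S, (((∏ w : {w : InfinitePlace L // IsComplex w},
            ((SignType.sign ((w.1.embedding (α (lineOf (formSign L α w) ((ρ w).symm 1)))).re) : ℤ) * archMajoritySign L (Matrix.diagonal α) w) : ℤ) : ℂ) *
          ∏ w : {w : InfinitePlace L // IsComplex w}, (Equiv.Perm.sign (ρ w) : ℂ)) *
          iteratedFDeriv ℝ sᶜ.card (fun c => archERhoG S (slotPerm ρ c) * F S (slotPerm ρ c)) (p + t • nrm w₀) (fun i => bzAdaptedVec w₀ (m (sᶜ.orderEmbOfFin rfl i))) := by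
    filter_upwards [hev] with t ht
    have htame : ∀ ρ ∈ partnerPerms S, slotPerm ρ (p + t • nrm w₀) ∈ InRegG (slotSign L α) S := forall_slotPerm_mem_inRegG_of_mem_regG (slotSign L α) S ht
    have hloc := archERho_mul_transfFam_eventuallyEq_of_tame L α μ hS F hI1 k (hk S) (regS_subset_inRegS S (regG_subset_regS S ht)) htame
    have hexp := iteratedFDeriv_apply_eq_sum_of_eventuallyEq_resolved L α hI1 k (partnerWeight L α S) htame hloc n (fun j => bzAdaptedVec w₀ (m j))
    simp only [Function.comp_def] at hexp
    unfold bzTwistedDeriv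
    rw [hexp]
    congr 1
    simp only [Finset.mul_sum]
    rw [Finset.sum_comm]
    refine Finset.sum_congr rfl fun s _ => Finset.sum_congr rfl fun ρ _ => ?_
    ring
  ---------------------------------------------------------------- Step B: the jump of the right-hand side of Step A
  have hcurve : Tendsto (fun t : ℝ => p + t • nrm w₀) (𝓝 (0 : ℝ)) (𝓝 p) := by
    have hc : Continuous fun t : ℝ => p + t • nrm w₀ := continuous_const.add (continuous_id.smul continuous_const)
    have h := hc.tendsto 0
    simp only [zero_smul, add_zero] at h
    exact h
  have hcontρ : Continuous (archERho S : ({w : InfinitePlace L // IsComplex w} → Fin 3 → ℝ) → ℂ) := by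
    unfold archERho
    refine continuous_finsetProd _ fun w _ => ?_
    by_cases hw : w ∈ S
    · simp only [if_pos hw]
      exact continuous_const
    · simp only [if_neg hw]
      have h0 : Continuous fun c : {w : InfinitePlace L // IsComplex w} → Fin 3 → ℝ => c w 0 := (continuous_apply 0).comp (continuous_apply w)
      have h2 : Continuous fun c : {w : InfinitePlace L // IsComplex w} → Fin 3 → ℝ => c w 2 := (continuous_apply 2).comp (continuous_apply w)
      exact continuous_subtype_val.comp (Circle.exp.continuous.comp ((h0.sub h2).div_const 2))
  have hEρ : Tendsto (fun t : ℝ => (archERho S (p + t • nrm w₀))⁻¹) (𝓝 (0 : ℝ)) (𝓝 (archERho S p)⁻¹) :=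
    ((hcontρ.tendsto p).comp hcurve).inv₀ (archERho_ne_zero S p)
  have hW : ContDiff ℝ ∞ (fun c : {w : InfinitePlace L // IsComplex w} → Fin 3 → ℝ => partnerWeight L α S * (archERho S c * (∏ w : {w : InfinitePlace L // IsComplex w}, (if w ∈ S then Complex.exp (((2 * k w + 1 : ℤ) : ℂ) * ((c w 2 : ℂ) * I))
            else (((Circle.exp (c w 0) : ℂ) * Circle.exp (c w 2)) ^ (k w)) * (Circle.exp (c w 2) : ℂ))))) := contDiff_const_mul_archERho_mul_unit S k _
  have hAt : ∀ s : Finset (Fin n), Tendsto (fun t : ℝ =>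
      iteratedFDeriv ℝ s.card (fun c : {w : InfinitePlace L // IsComplex w} → Fin 3 → ℝ => partnerWeight L α S * (archERho S c * (∏ w : {w : InfinitePlace L // IsComplex w}, (if w ∈ S then Complex.exp (((2 * k w + 1 : ℤ) : ℂ) * ((c w 2 : ℂ) * I))
            else (((Circle.exp (c w 0) : ℂ) * Circle.exp (c w 2)) ^ (k w)) * (Circle.exp (c w 2) : ℂ))))) (p + t • nrm w₀) (fun i => bzAdaptedVec w₀ (m (s.orderEmbOfFin rfl i)))) (𝓝 (0 : ℝ))
      (𝓝 (iteratedFDeriv ℝ s.card (fun c : {w : InfinitePlace L // IsComplex w} → Fin 3 → ℝ => partnerWeight L α S * (archERho S c * (∏ w : {w : InfinitePlace L // IsComplex w}, (if w ∈ S then Complex.exp (((2 * k w + 1 : ℤ) : ℂ) * ((c w 2 : ℂ) * I))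
            else (((Circle.exp (c w 0) : ℂ) * Circle.exp (c w 2)) ^ (k w)) * (Circle.exp (c w 2) : ℂ))))) p (fun i => bzAdaptedVec w₀ (m (s.orderEmbOfFin rfl i))))) := fun s =>
    ((continuous_eval_const _).tendsto _).comp (((hW.continuous_iteratedFDeriv (m := s.card) (by exact_mod_cast le_top)).tendsto p).comp hcurve)
  have hB := fun s : Finset (Fin n) => hasOneSidedJump_resolvedSum_jet L α hα hw₀ hcov hF hs02 hs1 hreg hx sᶜ.card (fun r => m (sᶜ.orderEmbOfFin rfl r))
  have hΦ := hasOneSidedJump_mul_of_tendsto hEρ (hasOneSidedJump_sum (Finset.univ : Finset (Finset (Fin n))) fun s _ =>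
    hasOneSidedJump_mul_of_tendsto (hAt s) (hB s))
  have hmain : HasOneSidedJump (fun t : ℝ => bzTwistedDeriv S n (fun j => bzAdaptedVec w₀ (m j)) (transfFam L α μ F S) (p + t • nrm w₀)) _ :=
    hasOneSidedJump_congr_eventuallyEq hΦ (by
      filter_upwards [hA] with t ht
      rw [ht])
  refine HasOneSidedJump.jump_congr hmain ?_
  ---------------------------------------------------------------- Step C: the Cayley side expanded at the tame point `q`
  have hlocq := archERho_mul_transfFam_eventuallyEq_of_tame L α μ hS'' F hI1'' k (hk _) hq htame''
  have hexpq := iteratedFDeriv_apply_eq_sum_of_eventuallyEq_resolved L α hI1'' k (partnerWeight L α (insert w₀ S)) htame'' hlocq n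
    (fun j => (bzCayVec (m j) : {w : InfinitePlace L // IsComplex w} → Fin 3 → ℝ))
  simp only [Function.comp_def] at hexpq
  unfold bzTwistedDeriv
  rw [hexpq, ← archERho_eq_archERho_insert_cayPt S hw₀ hs02]
  ---------------------------------------------------------------- Step D: term-by-term matching in `s`
  -- (R1)+(R2): the prefactor jets on the two sides
  have hR : ∀ s : Finset (Fin n),
      iteratedFDeriv ℝ s.card (fun c : {w : InfinitePlace L // IsComplex w} → Fin 3 → ℝ => partnerWeight L α (insert w₀ S) * (archERho (insert w₀ S) c * (∏ w : {w : InfinitePlace L // IsComplex w}, (if w ∈ (insert w₀ S) then Complex.exp (((2 * k w + 1 : ℤ) : ℂ) * ((c w 2 : ℂ) * I))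
            else (((Circle.exp (c w 0) : ℂ) * Circle.exp (c w 2)) ^ (k w)) * (Circle.exp (c w 2) : ℂ))))) (cayPt w₀ p) (fun i => (bzCayVec (m (s.orderEmbOfFin rfl i)) : {w : InfinitePlace L // IsComplex w} → Fin 3 → ℝ)) =
        2 * iteratedFDeriv ℝ s.card (fun c : {w : InfinitePlace L // IsComplex w} → Fin 3 → ℝ => partnerWeight L α S * (archERho S c * (∏ w : {w : InfinitePlace L // IsComplex w}, (if w ∈ S then Complex.exp (((2 * k w + 1 : ℤ) : ℂ) * ((c w 2 : ℂ) * I))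
            else (((Circle.exp (c w 0) : ℂ) * Circle.exp (c w 2)) ^ (k w)) * (Circle.exp (c w 2) : ℂ))))) p (fun i => bzAdaptedVec w₀ (m (s.orderEmbOfFin rfl i))) := by
    intro s
    have h1 := iteratedFDeriv_prefactor_adapted_eq_cayley S k (partnerWeight L α S) hw₀ hs02 s.card (fun r => m (s.orderEmbOfFin rfl r))
    rw [h1, iteratedFDeriv_const_mul_archERho_mul_unit_apply, iteratedFDeriv_const_mul_archERho_mul_unit_apply, hpw]
    ring
  -- the vanishing of the prefactor jet when `s` contains a normal letter
  have hR0 : ∀ s : Finset (Fin n), (∃ i ∈ s, m i = (w₀, 0)) →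
      iteratedFDeriv ℝ s.card (fun c : {w : InfinitePlace L // IsComplex w} → Fin 3 → ℝ => partnerWeight L α S * (archERho S c * (∏ w : {w : InfinitePlace L // IsComplex w}, (if w ∈ S then Complex.exp (((2 * k w + 1 : ℤ) : ℂ) * ((c w 2 : ℂ) * I))
            else (((Circle.exp (c w 0) : ℂ) * Circle.exp (c w 2)) ^ (k w)) * (Circle.exp (c w 2) : ℂ))))) p (fun i => bzAdaptedVec w₀ (m (s.orderEmbOfFin rfl i))) = 0 := by
    rintro s ⟨i, hi, hmi⟩
    obtain ⟨r, hr⟩ := exists_orderEmbOfFin_eq s m (w₀, 0) hi hmi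
    have h1 := iteratedFDeriv_prefactor_adapted_eq_cayley S k (partnerWeight L α S) hw₀ hs02 s.card (fun r => m (s.orderEmbOfFin rfl r))
    rw [h1]
    exact iteratedFDeriv_prefactor_cayley_eq_zero_of_normal (insert w₀ S) k _ (Finset.mem_insert_self w₀ S) _ (u := fun r => m (s.orderEmbOfFin rfl r)) hr
  -- the parity killer when `s` contains no normal letter and `a(m)` is odd
  have hY0 : ∀ s : Finset (Fin n), (∀ i ∈ s, m i ≠ (w₀, 0)) → Odd (Finset.univ.filter fun i => m i = (w₀, 0)).card →
      ∀ ρ' ∈ partnerPerms (insert w₀ S),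
        iteratedFDeriv ℝ sᶜ.card (fun c => archERhoG (insert w₀ S) (slotPerm ρ' c) * F (insert w₀ S) (slotPerm ρ' c)) (cayPt w₀ p) (fun i => (bzCayVec (m (sᶜ.orderEmbOfFin rfl i)) : {w : InfinitePlace L // IsComplex w} → Fin 3 → ℝ)) = 0 := by
    intro s hs hodd ρ' hρ'
    have h1 : ρ' w₀ = 1 := eq_one_of_mem_partnerPerms hρ' (Finset.mem_insert_self w₀ S)
    refine iteratedFDeriv_twisted_cayley_eq_zero_of_odd L α (Finset.mem_insert_self w₀ S) hF.2.1 h1 (cayPt_apply_self_zero w₀ p)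
      (u := fun r => m (sᶜ.orderEmbOfFin rfl r)) ?_
    have hcount : (Finset.univ.filter fun r : Fin sᶜ.card => m (sᶜ.orderEmbOfFin rfl r) = (w₀, 0)).card = (Finset.univ.filter fun i => m i = (w₀, 0)).card := by
      convert card_filter_compl_orderEmbOfFin_eq s m (w₀, 0) hs
    rw [hcount]
    exact hodd
  ---------------------------------------------------------------- assembling (abstract lemmas matched by unification)
  refine sum_assembly (partnerPerms (insert w₀ S)) ((archERho S p)⁻¹) (2 * jc' S w₀ 0 2 * bzCayScalar w₀ m) _ _ _ fun s => ?_
  refine persum_identity (partnerPerms (insert w₀ S)) _ _ _ _ _ (jc' S w₀ 0 2) _ (bzCayScalar w₀ m) (hR s) ?_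
  by_cases hnormal : ∃ i ∈ s, m i = (w₀, 0)
  · exact Or.inl (hR0 s hnormal)
  · push Not at hnormal
    have hcount : (Finset.univ.filter fun r : Fin sᶜ.card => m (sᶜ.orderEmbOfFin rfl r) = (w₀, 0)).card = (Finset.univ.filter fun i => m i = (w₀, 0)).card := by
      convert card_filter_compl_orderEmbOfFin_eq s m (w₀, 0) hnormal
    rcases Nat.even_or_odd (Finset.univ.filter fun i => m i = (w₀, 0)).card with heven | hodd
    · refine Or.inr (Or.inl ⟨?_, ?_⟩)
      · rw [show (Finset.univ.filter fun r : Fin sᶜ.card => (fun r => m (sᶜ.orderEmbOfFin rfl r)) r = (w₀, 0)).card =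
            (Finset.univ.filter fun i => m i = (w₀, 0)).card from hcount, heven.neg_one_pow, Complex.ofReal_one]
      · unfold bzCayScalar
        rw [show (Finset.univ.filter fun r : Fin sᶜ.card => (fun r => m (sᶜ.orderEmbOfFin rfl r)) r = (w₀, 0)).card =
            (Finset.univ.filter fun i => m i = (w₀, 0)).card from hcount]
    · refine Or.inr (Or.inr ⟨?_, fun ρ' hρ' => hY0 s hnormal hodd ρ' hρ'⟩)
      rw [show (Finset.univ.filter fun r : Fin sᶜ.card => (fun r => m (sᶜ.orderEmbOfFin rfl r)) r = (w₀, 0)).card =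
            (Finset.univ.filter fun i => m i = (w₀, 0)).card from hcount, hodd.neg_one_pow, Complex.ofReal_neg, Complex.ofReal_one]

end Pointwise

end Literature.NumberTheory.Rogawski1990

end
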